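import Summits.Ventures.CertifiedQuantumChemistry.Rows.OneBodySectorFermiSum
import HarnessLib

/-!
# Ventures/CertifiedQuantumChemistry — Rows/OneBodySectorExactness.lean: the `S_z`-SECTOR DQG and
# DQGT1T2′ programmes are EXACT for one-body Hamiltonians

HONEST FRAMING (verbatim): certified bounds for a stated model Hamiltonian in a stated basis; not a
claim about the real molecule beyond that model.

Seat rdm-B, ROWS courtesy file (theorems only; no `def`, no notation); part 2 of 2, on top of
`Rows/OneBodySectorFermiSum.lean` (pair-level bathtub bound, Fermi sea, closed forms). Here the
abstract eigen-data are instantiated with Mathlib's spectral theorem and the Fermi sets with the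
tree's `exists_fermiSet`, giving hypothesis-light statements:

* `eigenbasis_of_integrals` — Hermitian integrals `h_pq = conj h_qp` ⇒ the eigenvector unitary of
  `Matrix.of h` is a complete orthonormal eigenbasis in the mode form of the free-fermion files;
* `card_le_of_isDQGFeasibleSector` — a sector-feasible pair forces `a, b ≤ |Λ|`;
* **`sectorGroundEnergy_le_re_rdmEnergy_oneBody`** — for Hermitian `h`, real `h_nuc` and NO two-body
  part, the functional at EVERY pair of `IsDQGFeasibleSector a b` is `≥ E₀(Ĥ; a, b)` — all ranks,
  all sectors;
* **`forall_isDQGFeasibleSector_le_iff_oneBody`**, **`pqgSectorEnergy_eq_sectorGroundEnergy_oneBody`**,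
  **`pqgT1T2pSectorEnergy_eq_sectorGroundEnergy_oneBody`** — EXACTNESS: the sector programmes of the
  cell (DQG and DQGT1T2′ rungs with the `(N_α, N_β)` rows) have NO relaxation gap for any one-body
  model (Hubbard / PPP at `U = 0`, Hückel, the bare one-electron part of an FCIDUMP): `E_PQG(a, b) =
  E_PQGT1T2′(a, b) = E₀(Ĥ; a, b)`;
* `pqgSectorEnergy_oneBody_eq_fermiSum_eigenvalues` — the free-fermion oracle with Mathlib's
  `eigenvalues`: both numbers equal `Σ_{F↑} λ + Σ_{F↓} λ + Re h_nuc` for Fermi sets of the spectrum.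

Everything is PROVED (0 sorry, standard axioms); no definitions, no named facts. NOT claimed: anything
about `g ≠ 0`.

References: D. A. Mazziotti, in *Reduced-Density-Matrix Mechanics*, Adv. Chem. Phys. 134 (Wiley 2007)
ch. 3 §II.E.3 class (i), §II.F; M. Nakata et al., J. Chem. Phys. 128 (2008) 164113 §II.C (`E_PQG`,
the chain); E. H. Lieb, M. Loss, *Analysis* (AMS 2001) Thm 1.14; P. W. Ayers, E. R. Davidson, Adv.
Chem. Phys. 134 (2007) ch. 16 §III.D eq. (47) (`ρ_i ≤ 1` in every rank).

Tree (REUSED): part 1; `exists_fermiSet` (`FreeFermionSectorEnergyDeviation`);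
`IsDQGFeasibleSector.diag_le_one'` (`WeinholdWilsonInequalities`); `le_pqgSectorEnergy_iff`,
`pqgSectorEnergy_le_sectorGroundEnergy`, `pqgT1T2pSectorEnergy_le_sectorGroundEnergy`,
`pqgSectorEnergy_le_pqgT1T2pSectorEnergy` (`RelaxationEnergyHierarchy`);
`le_sectorGroundEnergy_of_forall_isDQGFeasibleSector`. Mathlib: `Matrix.IsHermitian.eigenvectorUnitary`,
`eigenvectorUnitary_apply`, `mulVec_eigenvectorBasis`, `eigenvalues`, `Matrix.mem_unitaryGroup_iff(')`.
-/

noncomputable section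

namespace Summit.Ventures.CertifiedQuantumChemistry

open Matrix Finset
open Literature.MathematicalPhysics.QuantumLattice Literature.MathematicalPhysics.QuantumChemistry
  Literature.MathematicalPhysics.QuantumLattice.RayleighBound
  Literature.MathematicalPhysics.QuantumLattice.HubbardBandBottom
open scoped ComplexOrder

variable {Λ : Type*} [LinearOrder Λ] [Fintype Λ] {κ : Type*}

/-! ### Exactness of the sector programmes for one-body Hamiltonians -/

section Exact

omit [LinearOrder Λ] in
/-- The eigenvector unitary of the Hermitian one-electron matrix supplies a complete orthonormal
eigenbasis `v_k(x) = U_{xk}` with levels `eigenvalues k` (Mathlib's spectral theorem, repackaged in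
the mode form of the free-fermion files). -/
theorem eigenbasis_of_integrals [DecidableEq Λ] {h : Λ → Λ → ℂ} (hh : ∀ p q, star (h p q) = h q p) :
    (∀ x y : Λ, ∑ k, ((isHermitian_of_integrals hh).eigenvectorUnitary : Matrix Λ Λ ℂ) x k *
        star (((isHermitian_of_integrals hh).eigenvectorUnitary : Matrix Λ Λ ℂ) y k) =
        if x = y then 1 else 0) ∧
      (∀ k l, star (fun x => ((isHermitian_of_integrals hh).eigenvectorUnitary : Matrix Λ Λ ℂ) x k) ⬝ᵥ
        (fun x => ((isHermitian_of_integrals hh).eigenvectorUnitary : Matrix Λ Λ ℂ) x l) =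
        if k = l then 1 else 0) ∧
      (∀ k, Matrix.of h *ᵥ (fun x => ((isHermitian_of_integrals hh).eigenvectorUnitary : Matrix Λ Λ ℂ) x k) =
        (((isHermitian_of_integrals hh).eigenvalues k : ℝ) : ℂ) •
          fun x => ((isHermitian_of_integrals hh).eigenvectorUnitary : Matrix Λ Λ ℂ) x k) := by
  set hA := isHermitian_of_integrals hh with hAdef
  set U : Matrix Λ Λ ℂ := (hA.eigenvectorUnitary : Matrix Λ Λ ℂ) with hUdef
  have hUU : U * star U = 1 := Matrix.mem_unitaryGroup_iff.1 hA.eigenvectorUnitary.2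
  have hUU' : star U * U = 1 := Matrix.mem_unitaryGroup_iff'.1 hA.eigenvectorUnitary.2
  refine ⟨fun x y => ?_, fun k l => ?_, fun k => ?_⟩
  · have h1 := congrFun (congrFun hUU x) y
    simp only [Matrix.mul_apply, Matrix.star_apply, Matrix.one_apply] at h1
    exact h1
  · have h1 := congrFun (congrFun hUU' k) l
    simp only [Matrix.mul_apply, Matrix.star_apply, Matrix.one_apply] at h1
    rw [dotProduct]
    simpa only [Pi.star_apply] using h1
  · have hcol : (fun x => U x k) = ⇑(hA.eigenvectorBasis k) := by
      funext x; rw [hUdef, Matrix.IsHermitian.eigenvectorUnitary_apply]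
    rw [hcol, hA.mulVec_eigenvectorBasis k]
    funext x
    simp only [Pi.smul_apply, Complex.real_smul, smul_eq_mul]

/-- A sector-feasible pair exists only in a non-trivial sector: `a, b ≤ |Λ|` (each diagonal entry of
`γ` has real part `≤ 1` in every rank, and the species traces are `a`, `b`). Ayers–Davidson (2007)
§III.D eq. (47) via `IsDQGFeasibleSector.diag_le_one'`. -/
theorem card_le_of_isDQGFeasibleSector {a b : ℕ} {γ : Matrix (Orb Λ) (Orb Λ) ℂ}
    {Γ : Matrix (Orb Λ × Orb Λ) (Orb Λ × Orb Λ) ℂ} (hf : IsDQGFeasibleSector a b γ Γ) :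
    a ≤ Fintype.card Λ ∧ b ≤ Fintype.card Λ := by
  have key : ∀ (σ : Fin 2) (m : ℕ), ∑ x, γ (orb x σ) (orb x σ) = (m : ℂ) → m ≤ Fintype.card Λ := by
    intro σ m hm
    have h1 : (m : ℝ) = ∑ x, (γ (orb x σ) (orb x σ)).re := by
      rw [← Complex.re_sum, hm, Complex.natCast_re]
    have h2 : ∑ x, (γ (orb x σ) (orb x σ)).re ≤ ∑ _x : Λ, (1 : ℝ) :=
      Finset.sum_le_sum fun x _ => hf.diag_le_one' _
    rw [Finset.sum_const, Finset.card_univ, nsmul_eq_mul, mul_one, ← h1] at h2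
    exact_mod_cast h2
  exact ⟨key 0 a hf.trace_up, key 1 b hf.trace_down⟩

/-- **The sector DQG lower bound is exact for one-body Hamiltonians (pair form).** For Hermitian
one-electron integrals, a real constant and NO two-body part, the energy functional at every pair of
`IsDQGFeasibleSector a b` is `≥ E₀(Ĥ; a, b)` — in every rank and every sector (bathtub per species +
the Fermi sea). Mazziotti (2007) ch. 3 §II.E.3 class (i) ("all one-particle Hamiltonians"), §II.F. -/
theorem sectorGroundEnergy_le_re_rdmEnergy_oneBody {h : Λ → Λ → ℂ} {hnuc : ℂ}
    (hh : ∀ p q, star (h p q) = h q p) (hn : star hnuc = hnuc) {a b : ℕ}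
    {γ : Matrix (Orb Λ) (Orb Λ) ℂ} {Γ : Matrix (Orb Λ × Orb Λ) (Orb Λ × Orb Λ) ℂ}
    (hf : IsDQGFeasibleSector a b γ Γ) :
    sectorGroundEnergy (molecularHamiltonian h 0 hnuc) a b ≤ (rdmEnergy h 0 hnuc γ Γ).re := by
  classical
  obtain ⟨hv, hon, heig⟩ := eigenbasis_of_integrals hh
  obtain ⟨ha, hb⟩ := card_le_of_isDQGFeasibleSector hf
  obtain ⟨Fu, eu, hFu_card, hFu, hFu'⟩ := exists_fermiSet (isHermitian_of_integrals hh).eigenvalues ha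
  obtain ⟨Fd, ed, hFd_card, hFd, hFd'⟩ := exists_fermiSet (isHermitian_of_integrals hh).eigenvalues hb
  subst hFu_card hFd_card
  exact (sectorGroundEnergy_oneBody_le_fermiSum hh hn _ _ hon heig Fu Fd).trans
    (fermiSum_le_re_rdmEnergy_oneBody h hnuc _ _ hv hon heig Fu Fd eu ed hFu hFu' hFd hFd' hf)

/-- **EXACTNESS (no relaxation gap in any `S_z` sector for one-body Hamiltonians).** For Hermitian
`h`, real `h_nuc`, no two-body part and a non-trivial sector `a, b ≤ |Λ|`: a real number lies below the
energy functional on the whole sector-feasible set `IsDQGFeasibleSector a b` iff it lies below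
`E₀(Ĥ; a, b)` (`→`: the relaxation bound `le_sectorGroundEnergy_of_forall_isDQGFeasibleSector`;
`←`: `sectorGroundEnergy_le_re_rdmEnergy_oneBody`). Mazziotti (2007) §II.E.3 (i), §II.F. -/
theorem forall_isDQGFeasibleSector_le_iff_oneBody {h : Λ → Λ → ℂ} {hnuc : ℂ}
    (hh : ∀ p q, star (h p q) = h q p) (hn : star hnuc = hnuc) {a b : ℕ}
    (ha : a ≤ Fintype.card Λ) (hb : b ≤ Fintype.card Λ) (c : ℝ) :
    (∀ γ Γ, IsDQGFeasibleSector a b γ Γ → c ≤ (rdmEnergy h 0 hnuc γ Γ).re) ↔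
      c ≤ sectorGroundEnergy (molecularHamiltonian h 0 hnuc) a b :=
  ⟨fun hc => le_sectorGroundEnergy_of_forall_isDQGFeasibleSector
      (molecularHamiltonian_zero_isHermitian hh hn) ha hb hc,
    fun hc _ _ hf => hc.trans (sectorGroundEnergy_le_re_rdmEnergy_oneBody hh hn hf)⟩

/-- **`E_PQG(a, b) = E₀(Ĥ; a, b)` for one-body Hamiltonians**: the optimal value of the cell's
sector DQG programme equals the exact sector energy (Hermitian `h`, real `h_nuc`, `a, b ≤ |Λ|`).
Mazziotti (2007) §II.E.3 (i), §II.F; Nakata et al. (2008) §II.C for `E_PQG`. -/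
theorem pqgSectorEnergy_eq_sectorGroundEnergy_oneBody {h : Λ → Λ → ℂ} {hnuc : ℂ}
    (hh : ∀ p q, star (h p q) = h q p) (hn : star hnuc = hnuc) {a b : ℕ}
    (ha : a ≤ Fintype.card Λ) (hb : b ≤ Fintype.card Λ) :
    pqgSectorEnergy h 0 hnuc a b = sectorGroundEnergy (molecularHamiltonian h 0 hnuc) a b :=
  le_antisymm (pqgSectorEnergy_le_sectorGroundEnergy (molecularHamiltonian_zero_isHermitian hh hn) ha hb)
    ((le_pqgSectorEnergy_iff h 0 hnuc ha hb).2
      fun _ _ hf => sectorGroundEnergy_le_re_rdmEnergy_oneBody hh hn hf)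

/-- **`E_PQG(a, b) = E_PQGT1T2′(a, b) = E₀(Ĥ; a, b)` for one-body Hamiltonians**: the whole sector
hierarchy collapses (the `T1`/`T2′` rows add nothing at `g = 0`). Mazziotti (2007) §II.E.3 (i);
Nakata et al. (2008) §II.C for the chain. -/
theorem pqgT1T2pSectorEnergy_eq_sectorGroundEnergy_oneBody {h : Λ → Λ → ℂ} {hnuc : ℂ}
    (hh : ∀ p q, star (h p q) = h q p) (hn : star hnuc = hnuc) {a b : ℕ}
    (ha : a ≤ Fintype.card Λ) (hb : b ≤ Fintype.card Λ) :
    pqgT1T2pSectorEnergy h 0 hnuc a b = sectorGroundEnergy (molecularHamiltonian h 0 hnuc) a b :=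
  le_antisymm
    (pqgT1T2pSectorEnergy_le_sectorGroundEnergy (molecularHamiltonian_zero_isHermitian hh hn) ha hb)
    ((pqgSectorEnergy_eq_sectorGroundEnergy_oneBody hh hn ha hb).symm.le.trans
      (pqgSectorEnergy_le_pqgT1T2pSectorEnergy h 0 hnuc ha hb))

/-- **The free-fermion oracle (Mathlib-eigenvalue form).** For Hermitian `h`, real `h_nuc` and Fermi
sets `F↑, F↓ ⊆ Λ` of the eigenvalues `λ` of `Matrix.of h` (lowest levels inside): BOTH the exact
sector energy and the optimal value of the sector DQG programme of `Ĥ(h, 0, h_nuc)` at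
`(N_α, N_β) = (|F↑|, |F↓|)` equal `Σ_{F↑} λ + Σ_{F↓} λ + Re h_nuc`. Mazziotti (2007) §II.E.3 (i);
Bardeen–Cooper–Schrieffer (1957) §II. -/
theorem pqgSectorEnergy_oneBody_eq_fermiSum_eigenvalues {h : Λ → Λ → ℂ} {hnuc : ℂ}
    (hh : ∀ p q, star (h p q) = h q p) (hn : star hnuc = hnuc) (Fu Fd : Finset Λ) (eu ed : ℝ)
    (hFu : ∀ k ∈ Fu, (isHermitian_of_integrals hh).eigenvalues k ≤ eu)
    (hFu' : ∀ k ∉ Fu, eu ≤ (isHermitian_of_integrals hh).eigenvalues k)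
    (hFd : ∀ k ∈ Fd, (isHermitian_of_integrals hh).eigenvalues k ≤ ed)
    (hFd' : ∀ k ∉ Fd, ed ≤ (isHermitian_of_integrals hh).eigenvalues k) :
    pqgSectorEnergy h 0 hnuc Fu.card Fd.card =
        ∑ k ∈ Fu, (isHermitian_of_integrals hh).eigenvalues k +
          ∑ k ∈ Fd, (isHermitian_of_integrals hh).eigenvalues k + hnuc.re ∧
      sectorGroundEnergy (molecularHamiltonian h 0 hnuc) Fu.card Fd.card =
        ∑ k ∈ Fu, (isHermitian_of_integrals hh).eigenvalues k +
          ∑ k ∈ Fd, (isHermitian_of_integrals hh).eigenvalues k + hnuc.re := by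
  classical
  obtain ⟨hv, hon, heig⟩ := eigenbasis_of_integrals hh
  exact ⟨pqgSectorEnergy_oneBody_eq_fermiSum h hnuc _ _ hv hon heig Fu Fd eu ed hFu hFu' hFd hFd',
    sectorGroundEnergy_oneBody_eq_fermiSum hh hn _ _ hv hon heig Fu Fd eu ed hFu hFu' hFd hFd'⟩

end Exact

end Summit.Ventures.CertifiedQuantumChemistry

end
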